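import Summits.BirchSwinnertonDyer.BirchSwinnertonDyer.Theorems.GenusKolyvaginAtTwoGenusPrimitiveSupplyAtTwoArchimedeanUnramifiedFrame
import Summits.BirchSwinnertonDyer.BirchSwinnertonDyer.Theorems.GenusKolyvaginAtTwoGenusPrimitiveSupplyAtTwoTwistSelmerTransferUpRat
import Summits.BirchSwinnertonDyer.BirchSwinnertonDyer.Theorems.GenusKolyvaginAtTwoMazurRubinCor34iSingleton
import Summits.BirchSwinnertonDyer.BirchSwinnertonDyer.Theorems.GenusKolyvaginAtTwoMazurRubinLemma210Rat
import Literature.NumberTheory.EllipticCurves.ArtinFormalismQuadraticLocalProofs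
import HarnessLib

/-!
# Route `GenusKolyvaginAtTwo`, crux #2 `GenusPrimitiveSupplyAtTwo` (stmt-BirchSwinnertonDyer-22136):
# Cor. 3.4 (i) with `T = {v₀}` finite from the FIVE-row finite menu (every number field), and the PRIME HEEGNER TWIN law over `ℚ`
# WITHOUT «`2` split in `K`» — `K = ℚ(√−ℓ)` with `2` split OR inert (`ℓ ≡ 7` or `3 (mod 8)`), unconditionally, no image hypothesis

Width seat `bsd-line-gk2-p5` g12 (cell `bsd-f1-sign2`, SUPPLY lineage), file 46 of the series: sequel of `…TwistMasterFrame` (§97) /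
`…ArchimedeanUnramifiedFrame` (§98) and of gk2-p4 g12's `…TwistMenuFrame` (§79: `T = {v₀}` finite, FOUR-row menu) /
`…MazurRubinCor34iSingleton` (§H–§I). THEOREMS ONLY (no definition, no named fact, no `sorry`, no local instance); helper
`--supports stmt-BirchSwinnertonDyer-22136`; no item is closed; BSD is not proved by any of this.

WHAT. Every prime-Heegner-twin law of the lineage (`GenusKolyPR.cor34i_twin_prime_heegner`, `…natCard_selmerGroup_twin_eq_two(_iff_not_strict)`,
gk2-p4's `MazurRubin2010.cor34i_singleton_rat_holds`, the SUPPLY″ theorems) carries «`2` SPLIT in `K`» (`d_K ≡ 1 (mod 8)`, i.e. `ℓ ≡ 7 (mod 8)`),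
because the finite menus had no row at a dyadic place other than the split one. With the unramified semistable row on the master datum:

* §102 **`GenusKolyTwistLocal.natCard_selmerGroup_twist_directed_of_menu₅_frame`** — Cor. 3.4 (i) with `T = {v₀}` (`v₀ ∤ 2` good for `W`,
  ramified in `K(√d)`, `#W(K_{v₀})[2] = 2`), BOTH directions, every finite `v ≠ v₀` on the FIVE-row menu (split | `v ∤ 2` Tamagawa-odd
  both | `v ∤ 2` good both | `v ∤ 2` silent both | unramified semistable at ANY residue characteristic), every infinite place split or
  `H¹ = 0` for both — UNCONDITIONAL, every number field, every elliptic `W` (§79 verbatim on §97/§98);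
* §103 `GenusKolyTwistLocal.twist_place_menu₅_finite_rat` — for `W/ℚ` globally minimal, `K` quadratic with `d_K = −ℓ` odd and Heegner
  for `N_W`, EVERY finite place `v ≠ v_ℓ` is on the five-row menu, with NO hypothesis at `2`: a prime of `N_W` splits (Heegner); `2 ∤ N_W`
  split ⟹ row 1, not split ⟹ `2 ∤ d_K` ⟹ `ι√d_K ∈ ℚ₂^{nr}` (Lemma210Rat `closureEmb_mem_maxUnramified_of_not_split`) and `W` good at `2`
  ⟹ row 5; an odd prime `∤ ℓ N_W` is good for both;
* §104 **`GenusKolyTwin.cor34i_twin_prime_heegner_unramified`** — for `W/ℚ` globally minimal elliptic with `Δ_W < 0`, `K` imaginary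
  quadratic with `d_K = −ℓ` odd, Heegner for `N_W` (NO «`2` split», NO `ρ̄_{W,2}` onto), every elliptic model `Wd ≅ W^{(−ℓ)}`:
  `Sel₂(W)` strict at `ℓ` ⟹ `#Sel₂(Wd) = 2·#Sel₂(W)`, not strict ⟹ `#Sel₂(W) = 2·#Sel₂(Wd)`; corollaries
  `natCard_selmerGroup_twin_eq_two_unramified` (`#Sel₂(W) = 1 ⟹ #Sel₂(Wd) = 2`) and `natCard_selmerGroup_twin_eq_two_iff_not_strict_unramified`
  (`#Sel₂(W) = 4`). This widens the field choice of SUPPLY″ / the `T-q₀` lanes to prime Heegner fields with `2` INERT (`ℓ ≡ 3 (mod 8)`,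
  forced `2 ∤ N_W`).

References: [MazurRubin2010] Thm. 2.7, Lemmas 2.9–2.11, Prop. 3.3, Cor. 3.4 (i); [Kramer1981] Thm. 1, Props. 1, 2, 3, 7; [Mazur1972] Cor. 4.4;
[KramerTunnell1982] §6 Lemma 6.1; [MilneADT2006] I Thm. 2.8, 4.10; [GrossLMS1991] §1 (p. 235).
-/

set_option linter.dupNamespace false -- tree convention: `Summit.BirchSwinnertonDyer.BirchSwinnertonDyer.Theorems` (summit = sub-problem)
set_option autoImplicit false

noncomputable section

open scoped Classical ContRepresentation

/-! ## §102 Cor. 3.4 (i) with `T = {v₀}` finite, both directions, FIVE-row menu — unconditional -/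

namespace Summit.BirchSwinnertonDyer.BirchSwinnertonDyer.Theorems.GenusKolyTwistLocal

open WeierstrassCurve Field NumberField IsDedekindDomain Function
open Literature.NumberTheory.EllipticCurves Literature.NumberTheory.GaloisRepresentations
open Literature.NumberTheory.EllipticCurves.DokchitserDokchitser2012 (T xT)
open Literature.NumberTheory.GaloisRepresentations.IsNonarchimedeanLocalField
open Literature.NumberTheory.GaloisRepresentations.DiscreteGaloisModule (SelmerStructure)
open Literature.NumberTheory.GaloisCohomology
open Summit.BirchSwinnertonDyer.Rank1Residual.X11b
open Summit.BirchSwinnertonDyer.Rank1Residual.X11b.CongruentTransfer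
open Summit.BirchSwinnertonDyer.BirchSwinnertonDyer.Theorems.GenusKolyArch (transport_twist_agree_off_inr_of_menu₅)
open Summit.BirchSwinnertonDyer.BirchSwinnertonDyer.Theorems.SchneiderFreeAdditiveX3.PoitouTateReduction
  (poitouTate_selmerStructure_duality_real_holds)
open Rat.HeightOneSpectrum (primesEquiv natGenerator)

section Directed

variable {K : Type} [Field K] [NumberField K] (W Wd : WeierstrassCurve K) [W.IsElliptic] [Wd.IsElliptic]

/-- **MAZUR–RUBIN COR. 3.4 (i) WITH `T = {v₀}`, BOTH DIRECTIONS, FIVE-ROW MENU — UNCONDITIONAL** (every number field `K`, every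
elliptic `W`, the identification of §97). Data: `Wd = C • W^{(d)}`; `v₀ ∤ 2` good for `W`, ramified in `K(√d)` (`ι(√d) ∉ K_{v₀}^{nr}`),
`#W(K_{v₀})[2] = 2`; every finite `v ≠ v₀` on the FIVE-row menu (split ∨ `v ∤ 2` with both local Tamagawa numbers odd ∨ `v ∤ 2` good for
both ∨ `v ∤ 2` silent for both ∨ UNRAMIFIED in `K(√d)` with `W` good or multiplicative-odd, any residue characteristic), every infinite
place split or with `H¹ = 0` for both. Conclusion: `Sel₂(W)` strict at `v₀` ⟹ `#Sel₂(Wd) = #Sel₂(W)·2`, and not strict ⟹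
`#Sel₂(Wd)·2 = #Sel₂(W)`. gk2-p4's §79 verbatim on the master datum (§97) and the five-row agreement (§98).
[cite: MazurRubin2010, Thm. 2.7, Lemmas 2.9–2.11, Prop. 3.3, Cor. 3.4 (i)] [cite: Kramer1981, Thm. 1, Props. 1, 2, 3, 7]
[cite: KramerTunnell1982, §6 Lemma 6.1] [cite: MilneADT2006, I Thm. 2.8, 4.10] -/
theorem natCard_selmerGroup_twist_directed_of_menu₅_frame {d : K} (hd : d ≠ 0) {C : VariableChange K}
    (hWd : C • W.quadraticTwist d = Wd)
    (v₀ : HeightOneSpectrum (𝓞 K)) (hv₀ : ((2 : ℕ) : 𝓞 K) ∉ v₀.asIdeal) (hv₀W : W.HasGoodReductionAt v₀)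
    (hram : closureEmb (K := K) (v₀.adicCompletion K) (geomSqrt d) ∉ maxUnramified (v₀.adicCompletion K))
    (ht : Nat.card (nsmulAddMonoidHom 2 : (W.baseChange (v₀.adicCompletion K)).toAffine.Point →+ _).ker = 2)
    (hfin : ∀ v : HeightOneSpectrum (𝓞 K), v ≠ v₀ →
      (∃ s : v.adicCompletion K, s ^ 2 = algebraMap K (v.adicCompletion K) d) ∨
      (((2 : ℕ) : 𝓞 K) ∉ v.asIdeal ∧
        ¬ 2 ∣ (W.baseChange (v.adicCompletion K)).localTamagawaNumber (v.adicCompletionIntegers K) ∧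
        ¬ 2 ∣ (Wd.baseChange (v.adicCompletion K)).localTamagawaNumber (v.adicCompletionIntegers K)) ∨
      (((2 : ℕ) : 𝓞 K) ∉ v.asIdeal ∧ W.HasGoodReductionAt v ∧ Wd.HasGoodReductionAt v) ∨
      (((2 : ℕ) : 𝓞 K) ∉ v.asIdeal ∧
        Nat.card (nsmulAddMonoidHom 2 : (W.baseChange (v.adicCompletion K)).toAffine.Point →+ _).ker = 1 ∧
        Nat.card (nsmulAddMonoidHom 2 : (Wd.baseChange (v.adicCompletion K)).toAffine.Point →+ _).ker = 1) ∨
      ((W.HasGoodReductionAt v ∨ (W.HasMultiplicativeReductionAt v ∧ Odd (W.ordMinimalDiscriminant v))) ∧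
        closureEmb (K := K) (v.adicCompletion K) (geomSqrt d) ∈ maxUnramified (v.adicCompletion K)))
    (hinf : ∀ w : InfinitePlace K,
      (∃ s : w.Completion, s ^ 2 = algebraMap K w.Completion d) ∨
      ((∀ x : galoisCohomology (W.localGaloisModule w.Completion) 1, x = 0) ∧
        (∀ x : galoisCohomology (Wd.localGaloisModule w.Completion) 1, x = 0))) :
    ((∀ c ∈ (W.kummerSelmerStructure ((2 : ℕ) : ℤ)).selmerGroup,
        galoisCohomology.localization (W.torsionGaloisModule ((2 : ℕ) : ℤ)) (Sum.inr v₀) 1 c = 0) →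
      Nat.card (Wd.selmerGroup ((2 : ℕ) : ℤ)) = Nat.card (W.selmerGroup ((2 : ℕ) : ℤ)) * 2) ∧
    ((∃ c ∈ (W.kummerSelmerStructure ((2 : ℕ) : ℤ)).selmerGroup,
        galoisCohomology.localization (W.torsionGaloisModule ((2 : ℕ) : ℤ)) (Sum.inr v₀) 1 c ≠ 0) →
      Nat.card (Wd.selmerGroup ((2 : ℕ) : ℤ)) * 2 = Nat.card (W.selmerGroup ((2 : ℕ) : ℤ))) := by
  haveI : Fact (Nat.Prime 2) := ⟨Nat.prime_two⟩
  have hPT := poitouTate_selmerStructure_duality_real_holds (K := K)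
  have hEP : ∀ v : HeightOneSpectrum (𝓞 K), localEulerPoincareCharacteristic (v.adicCompletion K) := fun v ↦
    haveI : CharZero (v.adicCompletion K) := charZero_of_injective_algebraMap (algebraMap K _).injective
    localEulerPoincareCharacteristic_holds (v.adicCompletion K)
  -- the master datum: split agreement, unramified semistable row, Lemma 2.11, frame datum
  obtain ⟨φ, ψ, hψφ, hφψ, hsplit, hunr, htr, -, π, A, hπ, hA⟩ := exists_intertwining_master_frame W Wd hd hWd
  let 𝓐 : SelmerStructure (W.torsionGaloisModule ((2 : ℕ) : ℤ)) := fun v ↦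
    (Wd.kummerSelmerStructure ((2 : ℕ) : ℤ) v).map (galoisCohomology.map (φ.restrictField (Place.Completion v)) 1)
  have h𝓐 : ∀ v, 𝓐 v = (Wd.kummerSelmerStructure ((2 : ℕ) : ℤ) v).map
      (galoisCohomology.map (φ.restrictField (Place.Completion v)) 1) := fun _ ↦ rfl
  -- agreement off `v₀` from the five-row menu
  have hagree : ∀ v : Place K, v ≠ Sum.inr v₀ → 𝓐 v = W.kummerSelmerStructure ((2 : ℕ) : ℤ) v :=
    transport_twist_agree_off_inr_of_menu₅ W φ ψ hφψ hsplit hunr 𝓐 h𝓐 v₀ hfin hinf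
  -- transversality at `v₀` (Lemma 2.11)
  have htr' : 𝓐 (Sum.inr v₀) ⊓ W.kummerSelmerStructure ((2 : ℕ) : ℤ) (Sum.inr v₀) = ⊥ := by
    rw [h𝓐, kummerSelmerStructure_apply, kummerSelmerStructure_apply]
    exact htr v₀ hv₀W hv₀ hram
  -- `t_{v₀} = 2`
  have ht' : Nat.card (nsmulAddMonoidHom 2 : (W.baseChange (v₀.adicCompletion K)).toAffine.Point →+ _).ker *
      Nat.card (v₀.adicCompletionIntegers K ⧸ Ideal.span {((2 : ℕ) : v₀.adicCompletionIntegers K)}) = 2 := by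
    rw [ht, natCard_quotient_span_natCast_eq_one_of_not_mem v₀ hv₀, mul_one]
  -- the parity of the pair at `S = {v₀}`: Kramer's congruence for the framed `φ` (part 9)
  have hpar : IsSquare (Nat.card (Wd.selmerGroup ((2 : ℕ) : ℤ)) * Nat.card (W.selmerGroup ((2 : ℕ) : ℤ)) *
      (𝓐 (Sum.inr v₀)).relIndex (W.kummerSelmerStructure ((2 : ℕ) : ℤ) (Sum.inr v₀))) := by
    have hS : ∀ v ∉ ({(Sum.inr v₀ : Place K)} : Finset (Place K)), 𝓐 v = W.kummerSelmerStructure ((2 : ℕ) : ℤ) v :=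
      fun v hv ↦ hagree v (by simpa using hv)
    have h := GenusKolyKramer.isSquare_card_selmerGroup_mul_of_frame W Wd φ (Function.LeftInverse.injective hψφ) π hπ A hA
      𝓐 h𝓐 {(Sum.inr v₀ : Place K)} hS
    rwa [Finset.prod_singleton] at h
  refine ⟨fun hstrict ↦ ?_, fun hns ↦ ?_⟩
  · exact natCard_selmerGroup_eq_mul_of_transverse_of_forall_localization_eq_zero W Wd 2 hPT hEP φ ψ hψφ hφψ 𝓐 h𝓐 v₀
      hagree htr' ht' hstrict hpar
  · exact natCard_selmerGroup_mul_eq_of_transverse_of_localization_ne_zero W Wd 2 hPT hEP φ ψ hψφ hφψ 𝓐 h𝓐 v₀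
      hagree htr' ht' hns

end Directed

/-! ## §103 The five-row finite menu over `ℚ` for a Heegner twin — no hypothesis at `2` -/

section RatMenu

variable (W : WeierstrassCurve ℚ) [W.IsElliptic] [W.IsGloballyMinimal]

/-- **The FIVE-row finite place menu over `ℚ` for a Heegner twin, with NO hypothesis at `2`.** `W/ℚ` globally minimal, `K` quadratic
with `d_K = −ℓ` odd, Heegner for `N_W`, `v₀` the place over `ℓ`, `C • W^{(d_K)} = Wd`: every finite `v ≠ v₀` is on the five-row menu
— over a prime of `N_W`: split (Heegner); over `2 ∤ N_W`: split if `2` splits in `K`, otherwise (`2 ∤ d_K`) `ι√d_K ∈ ℚ₂^{nr}` and `W`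
is GOOD at `2` (the unramified-good row); over an odd prime `∤ ℓ N_W`: good for both. Compare file 5's `twist_place_menu_finite_rat`
(three-row menu, needs `2` split in `K`). [cite: MazurRubin2010, Prop. 3.3 (hypotheses), Lemma 2.10 (i), (ii), (v)]
[cite: GrossLMS1991, §1 (p. 235)] [cite: Mazur1972, Cor. 4.4] -/
theorem twist_place_menu₅_finite_rat {K : Type} [Field K] [NumberField K]
    (h2 : Module.finrank ℚ K = 2) (hodd : Odd (discr K)) (hH : SatisfiesHeegnerHypothesis (W.conductorNorm ℤ) K)
    {ℓ : ℕ} (hℓ : ℓ.Prime) (hd : discr K = -(ℓ : ℤ))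
    {v₀ : HeightOneSpectrum (𝓞 ℚ)} (hv₀ : (ℓ : 𝓞 ℚ) ∈ v₀.asIdeal)
    {Wd : WeierstrassCurve ℚ} {C : VariableChange ℚ} (hC : C • W.quadraticTwist (discr K : ℚ) = Wd) :
    ∀ v : HeightOneSpectrum (𝓞 ℚ), v ≠ v₀ →
      (∃ s : v.adicCompletion ℚ, s ^ 2 = algebraMap ℚ (v.adicCompletion ℚ) (discr K : ℚ)) ∨
      (((2 : ℕ) : 𝓞 ℚ) ∉ v.asIdeal ∧
        ¬ 2 ∣ (W.baseChange (v.adicCompletion ℚ)).localTamagawaNumber (v.adicCompletionIntegers ℚ) ∧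
        ¬ 2 ∣ (Wd.baseChange (v.adicCompletion ℚ)).localTamagawaNumber (v.adicCompletionIntegers ℚ)) ∨
      (((2 : ℕ) : 𝓞 ℚ) ∉ v.asIdeal ∧ W.HasGoodReductionAt v ∧ Wd.HasGoodReductionAt v) ∨
      (((2 : ℕ) : 𝓞 ℚ) ∉ v.asIdeal ∧
        Nat.card (nsmulAddMonoidHom 2 : (W.baseChange (v.adicCompletion ℚ)).toAffine.Point →+ _).ker = 1 ∧
        Nat.card (nsmulAddMonoidHom 2 : (Wd.baseChange (v.adicCompletion ℚ)).toAffine.Point →+ _).ker = 1) ∨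
      ((W.HasGoodReductionAt v ∨ (W.HasMultiplicativeReductionAt v ∧ Odd (W.ordMinimalDiscriminant v))) ∧
        closureEmb (K := ℚ) (v.adicCompletion ℚ) (geomSqrt (discr K : ℚ)) ∈ maxUnramified (v.adicCompletion ℚ)) := by
  intro v hv
  haveI := Fact.mk (primesEquiv v).2
  set p : ℕ := ((primesEquiv v : Nat.Primes) : ℕ) with hp
  have hpP : p.Prime := (primesEquiv v).2
  have hpv : (p : 𝓞 ℚ) ∈ v.asIdeal := Rat.HeightOneSpectrum.natCast_natGenerator_mem v
  by_cases hpN : p ∣ W.conductorNorm ℤ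
  · -- a prime of `N_W` splits in `K` (Heegner): `d_K` is a square in `ℚ_v`
    exact Or.inl (exists_sq_eq_discr_adicCompletion_of_ncard_primesOver h2 v (hH p hpP hpN))
  · have hW : W.HasGoodReductionAt v := by
      by_contra h
      exact hpN ((W.dvd_conductorNorm_iff v).mpr h)
    by_cases hp2 : p = 2
    · -- over `2 ∤ N_W`: `W` good at `2`; `2` split in `K` (row 1) or not split, `2 ∤ d_K` (row 5)
      by_cases hs2 : ((Ideal.span {(2 : ℤ)}).primesOver (𝓞 K)).ncard = 2
      · refine Or.inl (exists_sq_eq_discr_adicCompletion_of_ncard_primesOver h2 v ?_)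
        rw [← hp, hp2]
        exact hs2
      · have hp2' : ((primesEquiv v : Nat.Primes) : ℕ) = 2 := by rw [← hp]; exact hp2
        obtain ⟨x, -, hx⟩ := exists_sq_eq_discr_not_mem_range K h2
        have hx' : x ^ 2 = ((discr K : ℤ) : K) := by rw [hx, map_intCast]
        have hsf : Squarefree (discr K) := by
          rw [hd, ← Int.squarefree_natAbs, Int.natAbs_neg, Int.natAbs_natCast]
          exact (Nat.prime_iff.mp hℓ).squarefree
        have hd1 : discr K ≠ 1 := by rw [hd]; omega
        have h2d : ¬ (2 : ℤ) ∣ discr K := fun h ↦ (Int.not_even_iff_odd.mpr hodd) (even_iff_two_dvd.mpr h)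
        have hs2' : ¬ ((Ideal.span {(((primesEquiv v : Nat.Primes) : ℕ) : ℤ)}).primesOver (𝓞 K)).ncard = 2 := by
          rw [hp2', Nat.cast_ofNat]; exact hs2
        have h2d' : ¬ (((primesEquiv v : Nat.Primes) : ℕ) : ℤ) ∣ discr K := by
          rw [hp2', Nat.cast_ofNat]; exact h2d
        exact Or.inr (Or.inr (Or.inr (Or.inr ⟨Or.inl hW,
          GenusKolyTwistTamagawa.closureEmb_mem_maxUnramified_of_not_split h2 hx' hsf hd1 v hp2' hs2' h2d'⟩)))
    · -- `p ∤ 2 ℓ N_W`: odd, good for `W` and for `Wd`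
      have h2v : ((2 : ℕ) : 𝓞 ℚ) ∉ v.asIdeal :=
        GenusKolyTwistingPrime.natCast_not_mem_of_not_dvd hpP hpv fun h ↦
          hp2 ((Nat.prime_dvd_prime_iff_eq hpP Nat.prime_two).mp h)
      have hpℓ : p ≠ ℓ := by
        rintro hpℓ
        rw [hpℓ] at hpv
        exact hv (Literature.NumberTheory.EllipticCurves.HeightOneSpectrum.eq_of_natCast_mem_rat hℓ hpv hv₀)
      have hpd : ¬ ((p : ℕ) : ℤ) ∣ 2 * discr K := by
        rw [hd, mul_neg, dvd_neg]
        intro h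
        rcases (Nat.prime_iff_prime_int.mp hpP).dvd_or_dvd h with h2' | hℓ'
        · exact hp2 ((Nat.prime_dvd_prime_iff_eq hpP Nat.prime_two).mp (by exact_mod_cast h2'))
        · exact hpℓ ((Nat.prime_dvd_prime_iff_eq hpP hℓ).mp (by exact_mod_cast hℓ'))
      exact Or.inr (Or.inr (Or.inl ⟨h2v, hW, hasGoodReductionAt_of_smul_quadraticTwist W v hpd hW hC⟩))

end RatMenu

end Summit.BirchSwinnertonDyer.BirchSwinnertonDyer.Theorems.GenusKolyTwistLocal

/-! ## §104 The prime Heegner twin law over `ℚ` with `2` split OR inert — unconditional, no image hypothesis -/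

namespace Summit.BirchSwinnertonDyer.BirchSwinnertonDyer.Theorems.GenusKolyTwin

open WeierstrassCurve Field NumberField IsDedekindDomain Function
open Literature.NumberTheory.EllipticCurves Literature.NumberTheory.GaloisRepresentations
open Literature.NumberTheory.GaloisRepresentations.IsNonarchimedeanLocalField (maxUnramified)
open Literature.NumberTheory.GaloisCohomology
open Summit.BirchSwinnertonDyer.BirchSwinnertonDyer.Theorems.GenusKolyTwistLocal
open Rat.HeightOneSpectrum (primesEquiv natGenerator)

variable (W : WeierstrassCurve ℚ) [W.IsElliptic] [W.IsGloballyMinimal]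

/-- **MR COR. 3.4 (i) FOR THE PRIME HEEGNER TWIN, `2` SPLIT OR INERT, UNCONDITIONALLY** (no «`2` split in `K`», no `ρ̄_{W,2}`-onto):
for `W/ℚ` globally minimal elliptic with `Δ_W < 0`, `K` imaginary quadratic with `d_K = −ℓ` odd (`ℓ` prime) satisfying the Heegner
hypothesis for `N_W`, and every elliptic model `Wd ≅ W^{(−ℓ)}`: `Sel₂(W)` strict at `ℓ` ⟹ `#Sel₂(Wd) = 2·#Sel₂(W)`; not strict ⟹
`#Sel₂(W) = 2·#Sel₂(Wd)`. The only `T`-place is `v_ℓ` (`ℓ ∤ 2N_W` good, ramified, `#W(ℚ_ℓ)[2] = 2` on `Δ < 0`); every other finite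
place is on the five-row menu (§103: at `2 ∤ N_W` not split, Mazur's norm theorem), the real place has `H¹ = 0` for both (`Δ < 0`).
Compare `GenusKolyPR.cor34i_twin_prime_heegner` (needs `2` split and `ρ̄₂` onto).
[cite: MazurRubin2010, Thm. 2.7, Lemmas 2.9–2.11, Prop. 3.3, Cor. 3.4 (i)] [cite: Kramer1981, Thm. 1, Props. 3, 7] [cite: Mazur1972, Cor. 4.4]
[cite: MilneADT2006, I Thm. 2.8, 4.10] [cite: GrossLMS1991, §1 (p. 235)] -/
theorem cor34i_twin_prime_heegner_unramified {K : Type} [Field K] [NumberField K]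
    (hΔ : W.Δ < 0) (hK : IsImaginaryQuadratic K) (hodd : Odd (discr K))
    (hH : SatisfiesHeegnerHypothesis (W.conductorNorm ℤ) K)
    {ℓ : ℕ} [Fact ℓ.Prime] (hd : discr K = -(ℓ : ℤ)) (Wd : WeierstrassCurve ℚ) [Wd.IsElliptic]
    (hWd : ∃ C : VariableChange ℚ, C • W.quadraticTwist (discr K : ℚ) = Wd) :
    (W.selmerGroup 2 ≤ MazurRubin2010.strictLocalKer W ℚ_[ℓ] 2 →
        Nat.card (Wd.selmerGroup 2) = 2 * Nat.card (W.selmerGroup 2)) ∧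
      (¬ W.selmerGroup 2 ≤ MazurRubin2010.strictLocalKer W ℚ_[ℓ] 2 →
        Nat.card (W.selmerGroup 2) = 2 * Nat.card (Wd.selmerGroup 2)) := by
  have hℓ : ℓ.Prime := Fact.out
  obtain ⟨hℓ2, hℓN, -⟩ := prime_discr_facts W hK hodd hH hℓ hd
  -- the place `v₀` of `ℚ` over `ℓ`
  obtain ⟨v₀, hv₀⟩ : ∃ v : HeightOneSpectrum (𝓞 ℚ), ((primesEquiv v : Nat.Primes) : ℕ) = ℓ :=
    ⟨primesEquiv.symm ⟨ℓ, hℓ⟩, by rw [Equiv.apply_symm_apply]⟩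
  have hℓv₀ : (ℓ : 𝓞 ℚ) ∈ v₀.asIdeal := by
    rw [← hv₀]
    exact Rat.HeightOneSpectrum.natCast_natGenerator_mem v₀
  obtain ⟨C, hC⟩ := hWd
  have hd0 : (discr K : ℚ) ≠ 0 := by
    rw [hd]
    push_cast
    exact neg_ne_zero.mpr (by exact_mod_cast hℓ.ne_zero)
  -- `W` good at `v₀`, `v₀ ∤ 2`
  have hW : W.HasGoodReductionAt v₀ := by
    by_contra h
    exact hℓN (hv₀ ▸ (W.dvd_conductorNorm_iff v₀).mpr h)
  have h2v₀ : ((2 : ℕ) : 𝓞 ℚ) ∉ v₀.asIdeal :=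
    GenusKolyTwistingPrime.natCast_not_mem_of_not_dvd hℓ hℓv₀ fun h ↦
      hℓ2 ((Nat.prime_dvd_prime_iff_eq hℓ Nat.prime_two).mp h)
  -- `v₀(d_K) = 1`: `ι(√d_K) ∉ ℚ_{v₀}^{nr}`
  have hram : closureEmb (K := ℚ) (v₀.adicCompletion ℚ) (geomSqrt (discr K : ℚ)) ∉ maxUnramified (v₀.adicCompletion ℚ) := by
    apply GenusKolyTwistRamified.closureEmb_geomSqrt_not_mem_maxUnramified_rat v₀
    rw [hd]
    push_cast
    exact GenusKolyTwistRamified.valuation_neg_natCast_eq_exp_neg_one_of_mem v₀ hℓ hℓv₀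
  -- `#W(ℚ_{v₀})[2] = 2`
  have ht : Nat.card (nsmulAddMonoidHom 2 :
      (W.baseChange (v₀.adicCompletion ℚ)).toAffine.Point →+ _).ker = 2 := by
    rw [natCard_ker_nsmul_adicCompletion_eq_padic W v₀ 2]
    subst hv₀
    exact natCard_twoTorsion_padic_eq_two_of_discr_eq_neg_prime W hK hodd hH hd hΔ
  have h := natCard_selmerGroup_twist_directed_of_menu₅_frame W Wd hd0 hC v₀ h2v₀ hW hram ht
    (twist_place_menu₅_finite_rat W hK.1 hodd hH hℓ hd hℓv₀ hC) (twist_place_menu_infinite_rat W hΔ hd0 hC)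
  refine ⟨fun hs ↦ ?_, fun hns ↦ ?_⟩
  · have hstrict : ∀ c ∈ (W.kummerSelmerStructure ((2 : ℕ) : ℤ)).selmerGroup,
        galoisCohomology.localization (W.torsionGaloisModule ((2 : ℕ) : ℤ)) (Sum.inr v₀) 1 c = 0 := by
      apply GenusKolyTwistTamagawa.forall_selmer_localization_eq_zero_of_le_strictLocalKer W v₀
      subst hv₀
      exact hs
    have h1 := h.1 hstrict
    change Nat.card (Wd.selmerGroup 2) = Nat.card (W.selmerGroup 2) * 2 at h1
    omega
  · have hns' : ∃ c ∈ (W.kummerSelmerStructure ((2 : ℕ) : ℤ)).selmerGroup,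
        galoisCohomology.localization (W.torsionGaloisModule ((2 : ℕ) : ℤ)) (Sum.inr v₀) 1 c ≠ 0 := by
      apply exists_selmer_localization_ne_zero_of_not_le_strictLocalKer W v₀
      subst hv₀
      exact hns
    have h2 := h.2 hns'
    change Nat.card (Wd.selmerGroup 2) * 2 = Nat.card (W.selmerGroup 2) at h2
    omega

/-- **On `#Sel₂(W) = 1` the prime Heegner twin is `Sel₂`-minimal (`#Sel₂(Wd) = 2`), `2` split OR inert, UNCONDITIONALLY**
(`Sel₂(W) = 0` is strict at `ℓ`). [cite: MazurRubin2010, Cor. 3.4 (i) with Thm. 2.7] [cite: MilneADT2006, I Thm. 4.10] -/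
theorem natCard_selmerGroup_twin_eq_two_unramified {K : Type} [Field K] [NumberField K]
    (hΔ : W.Δ < 0) (hK : IsImaginaryQuadratic K) (hodd : Odd (discr K))
    (hH : SatisfiesHeegnerHypothesis (W.conductorNorm ℤ) K)
    {ℓ : ℕ} [Fact ℓ.Prime] (hd : discr K = -(ℓ : ℤ)) (Wd : WeierstrassCurve ℚ) [Wd.IsElliptic]
    (hWd : ∃ C : VariableChange ℚ, C • W.quadraticTwist (discr K : ℚ) = Wd)
    (h1 : Nat.card (W.selmerGroup 2) = 1) : Nat.card (Wd.selmerGroup 2) = 2 := by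
  have hs : W.selmerGroup 2 ≤ MazurRubin2010.strictLocalKer W ℚ_[ℓ] 2 := by
    haveI : Finite (W.selmerGroup 2) := W.finite_selmerGroup_holds (by norm_num)
    intro c hc
    have hc0 : (⟨c, hc⟩ : W.selmerGroup 2) = 0 := Subsingleton.elim (h := (Nat.card_eq_one_iff_unique.mp h1).1) _ _
    rw [show c = 0 from congrArg Subtype.val hc0]
    exact AddSubgroup.zero_mem _
  have h := (cor34i_twin_prime_heegner_unramified W hΔ hK hodd hH hd Wd hWd).1 hs
  omega

/-- **On `#Sel₂(W) = 4` the prime Heegner twin is `Sel₂`-minimal iff `Sel₂(W)` is not strict at `ℓ`, `2` split OR inert,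
UNCONDITIONALLY.** [cite: MazurRubin2010, Cor. 3.4 (i) with Thm. 2.7] [cite: MilneADT2006, I Thm. 4.10] -/
theorem natCard_selmerGroup_twin_eq_two_iff_not_strict_unramified {K : Type} [Field K] [NumberField K]
    (hΔ : W.Δ < 0) (hK : IsImaginaryQuadratic K) (hodd : Odd (discr K))
    (hH : SatisfiesHeegnerHypothesis (W.conductorNorm ℤ) K)
    {ℓ : ℕ} [Fact ℓ.Prime] (hd : discr K = -(ℓ : ℤ)) (Wd : WeierstrassCurve ℚ) [Wd.IsElliptic]
    (hWd : ∃ C : VariableChange ℚ, C • W.quadraticTwist (discr K : ℚ) = Wd)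
    (h4 : Nat.card (W.selmerGroup 2) = 4) :
    Nat.card (Wd.selmerGroup 2) = 2 ↔ ¬ W.selmerGroup 2 ≤ MazurRubin2010.strictLocalKer W ℚ_[ℓ] 2 := by
  obtain ⟨hup, hdown⟩ := cor34i_twin_prime_heegner_unramified W hΔ hK hodd hH hd Wd hWd
  constructor
  · intro h2 hs
    have := hup hs
    omega
  · intro hns
    have := hdown hns
    omega

end Summit.BirchSwinnertonDyer.BirchSwinnertonDyer.Theorems.GenusKolyTwin

end
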